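import Literature.Topology.FourManifolds.SliceDiscRadialMorse
import Literature.Analysis.ODE.CompactSupportFlow
import Mathlib.Geometry.Manifold.PartitionOfUnity
import Mathlib.Analysis.SpecialFunctions.Sqrt
import HarnessLib

/-!
# Slice discs with radial product structure off the critical windows

Topic `Literature/Topology/FourManifolds`; the second Morse-theoretic normal form of smooth slice
discs, after `SliceDiscRadialMorse.lean` (`Knot.IsSliceDisc.exists_isSliceDisc_radialMorse`:
every slice disc of `K` can be replaced by one, of the same knot, whose squared radius function
`ρ = ‖g‖²` is Morse on the open disc). Everything in this file is **proved**: no named facts,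
no `sorry`; the only definition is the private `radialProductReparam`, the explicit
reparametrisation formula, used through private lemmas only.

* `Literature.Topology.FourManifolds.Knot.IsSliceDisc.exists_isSliceDisc_radialProduct` (**main
  theorem**). For every smooth slice disc `f` of a knot `K` there is a finite set `S ⊆ [0, 1)`
  of levels such that for every `δ > 0` there is a slice disc `g` **of the same knot** with:
  `ρ_g = ‖g‖²` Morse on the open disc (literally the Morse clause of `Knot.IsRibbonDisc`);
  `S` is *exactly* the set of critical values of `ρ_g` on the open disc; and **off the
  `δ`-windows around `S ∪ {1}` the level links are radially constant**: for
  `0 < t ≤ t' ≤ 1 - δ` with `[t, t']` disjoint from every window `(c - δ, c + δ)`, `c ∈ S`,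
  `{g x | ‖x‖ ≤ 1, ‖g x‖² = t'} = √(t'/t) • {g x | ‖x‖ ≤ 1, ‖g x‖² = t}`.
  (`S` is fixed before `δ`, so the statement is not weakened by shrinking windows; a window
  below the boundary level `1` is necessary for any normal form keeping `g = K` on `∂𝔻²`.)
* `Literature.Topology.FourManifolds.exists_flow_apply_level_eq_add` — the ODE input (Milnor's
  "`f(φ(t)) = f(φ(0)) + t` along the curves of `ξ/ξ(f)`"): for `ρ` smooth on a
  finite-dimensional space, `D` compact and a slab `{x ∈ D | ρ x ∈ [α, β]} ⊆ interior D` without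
  critical points, a complete smooth flow on the whole space carrying level `r` of `D` to level
  `r + s` of `D` whenever `r, r + s ∈ [α, β]`.
* `Literature.Topology.FourManifolds.finite_setOf_fderiv_eq_zero_of_nondegenerate`,
  `eventually_eq_of_fderiv_eq_of_nondegenerate` — nondegenerate critical points are isolated,
  hence finite in number in a compact set (Milnor 1963, Cor. 2.3), in the `fderiv` /
  `iteratedFDeriv` language of `Knot.IsRibbonDisc`.
* `Literature.Topology.FourManifolds.Knot.IsSliceDisc.exists_isSliceDisc_radialProduct_step` —
  the one-interval straightening: given a slice disc `g` and `0 < α < a ≤ b < β < 1` with no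
  critical point of `ρ_g` on `ρ_g⁻¹[α, β] ∩ 𝔻²`, a slice disc `g'` of the same knot with
  `ρ_{g'} = ρ_g` near `𝔻²`, `g' = g` off `ρ_g⁻¹(α, β)`, and radially constant level links on
  `[a, b]`; `exists_isSliceDisc_radialProduct_list` iterates it over disjoint intervals.

## The construction (Milnor, *Morse theory* (1963), §3, Thm. 3.1; *h-cobordism* (1965), §3)

Let `g` be a slice disc with `ρ = ‖g‖²` and let `[α, β] ⊆ (0, 1)` contain no critical value of
`ρ|𝔻²`. Let `φ` be the flow of `exists_flow_apply_level_eq_add` (`ρ(φₛ x) = ρ x + s` on the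
slab), `τ : ℝ → ℝ` a smooth *retardation* with `τ = id` off `(α, β)`, `τ ≡ a` on `[a, b]`,
`τ[α, β] ⊆ [α, β]`, and `σ = √(t / τ t)` (smooth, `= 1` off `(α, β)`;
`exists_retardation_profile`). Put

  `g' x = σ(ρ x) • g(φ_{τ(ρ x) - ρ x}(x))` (`radialProductReparam`).

Then `‖g' x‖² = σ(ρ x)² τ(ρ x) = ρ x` on `𝔻²` (**same radius function**, so the Morse property,
the critical points and the critical values are unchanged, and radius separates levels), `g' = g`
where `ρ ∉ (α, β)` (in particular near `∂𝔻²`, so smoothness at the boundary, neatness and the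
boundary knot transfer), `g'` is injective on `𝔻²` (radius, then injectivity of `g` and of
`φₛ`) and immersive (a kernel vector `v` of `Dg'(x)` is tangent to the level, `dρ(v) = 0`, by
differentiating `‖g'‖² = ρ`; then `Dg'(x) v = σ • Dg (Dφₛ v)` with `Dg`, `Dφₛ` injective), and
level `t` of `g'` is `σ(t) • g(level τ(t) of g)`, which for `t ∈ [a, b]` is `√(t/a) •` (level
`a` of `g`): the level links on `[a, b]` are radially constant. The main theorem applies this
step once for each pair of consecutive elements `c < c'` of `S ∪ {1}` at distance `≥ 2δ` (`S` the
critical values of a Morse radius function: by neatness there are no critical points on `∂𝔻²`,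
so they are finite in number by `finite_setOf_fderiv_eq_zero_of_nondegenerate`), with
`[α, a, b, β] = [c + δ/2, c + δ, c' - δ, c' - δ/2]`; the modified regions are disjoint, so the
product structures obtained at earlier steps persist (`exists_isSliceDisc_radialProduct_list`).
Levels below `min S = min ρ` are empty.

## References

* J. Milnor, *Morse theory*, Ann. of Math. Studies 51 (1963), §3, Thm. 3.1 (the region between
  two levels without critical values is a product; proof by the normalised gradient flow),
  Cor. 2.3 (nondegenerate critical points are isolated). [MilnorMorseTheory1963]
* J. Milnor, *Lectures on the h-cobordism theorem* (1965), §3, Thm. 3.4 (product cobordisms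
  from the flow of `ξ/ξ(f)`). [MilnorHCobordism1965]
* S. Lang, *Differential and Riemannian Manifolds* (1995), Ch. IV §1 (flows of vector fields;
  the tree's `Literature.Analysis.ODE.globalFlow`). [Lang1995]
* R. Gompf, A. Stipsicz, *4-manifolds and Kirby calculus* (1999), §6.2 (the radius function on
  slice discs; level links).

## Design notes

* The flow is the global flow (`Literature.Analysis.ODE.globalFlow`, jointly `C^∞`) of the
  compactly supported field `(χ / dρ(∇ρ)) • ∇ρ` on the ambient plane, `∇ρ = Σᵢ dρ(bᵢ) bᵢ` the
  coordinate gradient in a basis and `χ` a smooth cutoff equal to `1` near the slab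
  (`exists_contDiff_eq_one_nhds_of_isCompact`, from Mathlib's smooth Urysohn lemma); the level
  identity along orbits is a real induction (`IsClosed.Icc_subset_of_forall_mem_nhdsWithin`).
* The statement quantifies `∃ S, ∀ δ > 0, ∃ g`: with `∃ δ` or with `S` allowed to grow the
  window condition could be made vacuous. Levels are taken over the closed disc `‖x‖ ≤ 1`, as
  in `Knot.IsSliceDisc`; the level `1` is the knot and the window `(1 - δ, 1]` is excluded.
* Not here: straightening the collar so that the disc is conical near `∂𝔻²` (which would remove
  the window at `1`), and the analogous statement for concordances.
-/

open scoped Manifold ContDiff Topology Pointwise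
open Function Set Metric Filter

noncomputable section

namespace Literature.Topology.FourManifolds

/-! ### Smooth cutoffs and the flow raising the levels of a function at unit speed -/

section LevelFlow

variable {E : Type*} [NormedAddCommGroup E] [NormedSpace ℝ E] [FiniteDimensional ℝ E]

/-- **Smooth cutoff equal to `1` near a compact set.** For `A` compact inside `O` open (in a
finite-dimensional real normed space) there is a `C^∞` function `χ`, equal to `1` on an open set
`G` with `A ⊆ G ⊆ O`, with compact support contained in `O` (smooth Urysohn lemma, Mathlib's
`exists_contMDiffMap_one_nhds_of_subset_interior`). [folklore] -/
theorem exists_contDiff_eq_one_nhds_of_isCompact {A O : Set E} (hA : IsCompact A) (hO : IsOpen O)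
    (hAO : A ⊆ O) :
    ∃ χ : E → ℝ, ContDiff ℝ ∞ χ ∧ (∃ G : Set E, IsOpen G ∧ A ⊆ G ∧ G ⊆ O ∧ ∀ x ∈ G, χ x = 1) ∧
      HasCompactSupport χ ∧ tsupport χ ⊆ O := by
  obtain ⟨V, hVo, hAV, hVO, hVc⟩ := exists_open_between_and_isCompact_closure hA hO hAO
  have hAint : A ⊆ interior (closure V) := hAV.trans (interior_maximal subset_closure hVo)
  obtain ⟨f, hf1, hf0, -⟩ :=
    exists_contMDiffMap_one_nhds_of_subset_interior 𝓘(ℝ, E) (n := (⊤ : ℕ∞)) hA.isClosed hAint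
  obtain ⟨G, hGo, hAG, hG1⟩ := mem_nhdsSet_iff_exists.1 hf1
  have hsupp : tsupport f ⊆ closure V :=
    closure_minimal (fun x hx ↦ by_contra fun h ↦ hx (hf0 x h)) isClosed_closure
  refine ⟨f, contMDiff_iff_contDiff.1 f.contMDiff, ⟨G ∩ V, hGo.inter hVo, subset_inter hAG hAV,
    fun x hx ↦ hVO (subset_closure hx.2), fun x hx ↦ hG1 hx.1⟩,
    HasCompactSupport.of_support_subset_isCompact hVc ((subset_tsupport f).trans hsupp),
    hsupp.trans hVO⟩

/-- Convex combinations stay in an interval: if `r` and `r + s` lie in `[α, β]` and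
`θ ∈ [0, 1]`, then `r + θ s ∈ [α, β]`. [folklore] -/
theorem add_mul_mem_Icc_of_mem_Icc {α β r s θ : ℝ} (hr : r ∈ Icc α β) (hrs : r + s ∈ Icc α β)
    (hθ : θ ∈ Icc (0 : ℝ) 1) : r + θ * s ∈ Icc α β := by
  obtain ⟨h1, h2⟩ := hr
  obtain ⟨h3, h4⟩ := hrs
  obtain ⟨h5, h6⟩ := hθ
  constructor <;> nlinarith [mul_nonneg h5 (sub_nonneg.2 h3),
    mul_nonneg (sub_nonneg.2 h6) (sub_nonneg.2 h1), mul_nonneg h5 (sub_nonneg.2 h4),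
    mul_nonneg (sub_nonneg.2 h6) (sub_nonneg.2 h2)]

variable [CompleteSpace E]

/-- **The flow raising the levels of a function at unit speed** (Milnor, *Morse theory* (1963),
§3, proof of Thm. 3.1; *Lectures on the h-cobordism theorem* (1965), proof of Thm. 3.4: along
the integral curves of `ξ / ξ(f)` one has `f(φ(t)) = f(φ(0)) + t`). Let `ρ` be `C^∞` on a
finite-dimensional space, `D` compact, `[α, β]` an interval such that the slab
`A = {x ∈ D | ρ x ∈ [α, β]}` lies in the interior of `D` and contains no critical point of `ρ`.
Then there is a complete `C^∞` flow `φ` on the whole space (the flow of the compactly supported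
field `(χ / dρ(∇ρ)) • ∇ρ`, `χ` a cutoff equal to `1` near `A`, `∇ρ` the coordinate gradient in
a basis) such that a point `x ∈ D` on the level `ρ = r ∈ [α, β]` is carried in time `s` to a
point of `D` on the level `r + s`, as long as `r + s ∈ [α, β]`.
[cite: MilnorMorseTheory1963, §3 Thm. 3.1] -/
theorem exists_flow_apply_level_eq_add {ρ : E → ℝ} (hρ : ContDiff ℝ ∞ ρ) {D : Set E}
    (hD : IsCompact D) {α β : ℝ} (hint : ∀ x ∈ D, ρ x ∈ Icc α β → x ∈ interior D)
    (hreg : ∀ x ∈ D, ρ x ∈ Icc α β → fderiv ℝ ρ x ≠ 0) :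
    ∃ φ : E → ℝ → E, ContDiff ℝ ∞ (fun p : E × ℝ ↦ φ p.1 p.2) ∧ (∀ x, φ x 0 = x) ∧
      (∀ x s t, φ x (s + t) = φ (φ x s) t) ∧
      ∀ x ∈ D, ρ x ∈ Icc α β → ∀ s : ℝ, ρ x + s ∈ Icc α β → φ x s ∈ D ∧ ρ (φ x s) = ρ x + s := by
  classical
  set b := Module.finBasis ℝ E with hb
  set grad : E → E := fun x ↦ ∑ i, (fderiv ℝ ρ x (b i)) • b i with hgrad
  set N : E → ℝ := fun x ↦ fderiv ℝ ρ x (grad x) with hN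
  have hDρ : ContDiff ℝ ∞ (fderiv ℝ ρ) := hρ.fderiv_right (m := ∞) (by simp)
  have hgrad_s : ContDiff ℝ ∞ grad :=
    ContDiff.sum fun i _ ↦ (hDρ.clm_apply contDiff_const).smul contDiff_const
  have hN_s : ContDiff ℝ ∞ N := hDρ.clm_apply hgrad_s
  have hN_eq : ∀ x, N x = ∑ i, fderiv ℝ ρ x (b i) ^ 2 := fun x ↦ by
    simp only [hN, hgrad, map_sum, map_smul, smul_eq_mul, sq]
  have hN_ne : ∀ x, fderiv ℝ ρ x ≠ 0 → N x ≠ 0 := by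
    intro x hx hNx
    apply hx
    have h0 : ∀ i, fderiv ℝ ρ x (b i) = 0 := fun i ↦ by
      have h := (Finset.sum_eq_zero_iff_of_nonneg (fun i _ ↦ sq_nonneg (fderiv ℝ ρ x (b i)))).1
        ((hN_eq x).symm.trans hNx) i (Finset.mem_univ i)
      exact pow_eq_zero_iff two_ne_zero |>.1 h
    exact ContinuousLinearMap.coe_injective (b.ext fun i ↦ by simp [h0 i])
  -- the slab `A`, the open set `O ⊇ A` on which the field will be the normalised gradient
  set A : Set E := {x ∈ D | ρ x ∈ Icc α β} with hA
  have hAc : IsCompact A := hD.inter_right (isClosed_Icc.preimage hρ.continuous)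
  set O : Set E := interior D ∩ {x | fderiv ℝ ρ x ≠ 0} with hO
  have hOo : IsOpen O :=
    isOpen_interior.inter (isOpen_ne_fun (hρ.continuous_fderiv (by simp)) continuous_const)
  have hAO : A ⊆ O := fun x hx ↦ ⟨hint x hx.1 hx.2, hreg x hx.1 hx.2⟩
  obtain ⟨χ, hχs, ⟨G, hGo, hAG, hGO, hχ1⟩, hχc, hχO⟩ :=
    exists_contDiff_eq_one_nhds_of_isCompact hAc hOo hAO
  -- the field
  set W : E → E := fun x ↦ (χ x / N x) • grad x with hW
  have hW_s : ContDiff ℝ ∞ W := by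
    refine contDiff_iff_contDiffAt.2 fun x ↦ ?_
    by_cases hx : N x = 0
    · have hxO : x ∉ tsupport χ := fun h ↦ (hχO h).2 (by_contra fun h' ↦ hN_ne x h' hx)
      have hev : W =ᶠ[𝓝 x] fun _ ↦ 0 := by
        filter_upwards [notMem_tsupport_iff_eventuallyEq.1 hxO] with y hy
        simp [hW, hy]
      exact contDiffAt_const.congr_of_eventuallyEq hev
    · exact (hχs.contDiffAt.div hN_s.contDiffAt hx).smul hgrad_s.contDiffAt
  have hWc : HasCompactSupport W := by
    refine hχc.mono ?_
    intro y hy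
    rw [mem_support] at hy ⊢
    intro h0
    apply hy
    simp [hW, h0]
  obtain ⟨Kc, hK⟩ := hW_s.lipschitzWith_of_hasCompactSupport hWc (by simp)
  obtain ⟨L, hL⟩ := hWc.exists_bound_of_continuous hW_s.continuous
  set φ := Literature.Analysis.ODE.globalFlow hK hL with hφ
  refine ⟨φ, Literature.Analysis.ODE.contDiff_globalFlow hW_s (by simp) hK hL,
    Literature.Analysis.ODE.globalFlow_zero hK hL, Literature.Analysis.ODE.globalFlow_add hK hL, ?_⟩
  -- speed of `ρ` along the flow
  have hderiv : ∀ x s, HasDerivAt (fun u ↦ ρ (φ x u)) (fderiv ℝ ρ (φ x s) (W (φ x s))) s :=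
    fun x s ↦ ((hρ.differentiable (by simp)) _).hasFDerivAt.comp_hasDerivAt s
      (Literature.Analysis.ODE.hasDerivAt_globalFlow hK hL x s)
  have hspeed : ∀ y ∈ G, fderiv ℝ ρ y (W y) = 1 := fun y hy ↦ by
    have hNy : N y ≠ 0 := hN_ne y (hGO hy).2
    simp only [hW, map_smul, smul_eq_mul]
    rw [hχ1 y hy]
    show 1 / N y * N y = 1
    field_simp
  -- local constancy of `ρ (φ x u) - u` while the orbit is in `G`
  have hloc : ∀ x u, φ x u ∈ G →
      ∀ᶠ u' in 𝓝 u, φ x u' ∈ G ∧ ρ (φ x u') - u' = ρ (φ x u) - u := by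
    intro x u hu
    have hcont : Continuous (φ x) := Literature.Analysis.ODE.continuous_globalFlow hK hL x
    obtain ⟨ε, hε, hball⟩ := Metric.isOpen_iff.1 (hGo.preimage hcont) u hu
    filter_upwards [ball_mem_nhds u hε] with u' hu'
    refine ⟨hball hu', ?_⟩
    have key := Convex.norm_image_sub_le_of_norm_hasDerivWithin_le
      (f := fun v ↦ ρ (φ x v) - v) (f' := fun _ ↦ (0 : ℝ)) (C := 0) (s := ball u ε)
      (fun v hv ↦ ?_) (fun _ _ ↦ by simp) (convex_ball u ε) (mem_ball_self hε) hu'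
    · have : ‖(ρ (φ x u') - u') - (ρ (φ x u) - u)‖ ≤ 0 := by simpa using key
      exact sub_eq_zero.1 (norm_le_zero_iff.1 this)
    · have h1 := (hderiv x v).sub (hasDerivAt_id v)
      rw [hspeed _ (hball hv), sub_self] at h1
      exact h1.hasDerivWithinAt
  -- real induction on the fraction of the time
  intro x hxD hρx s hs
  set S : Set ℝ := {θ | φ x (θ * s) ∈ D ∧ ρ (φ x (θ * s)) = ρ x + θ * s} with hS
  suffices h : Icc (0 : ℝ) 1 ⊆ S by
    have h1 := h ⟨zero_le_one, le_rfl⟩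
    simp only [hS, mem_setOf_eq, one_mul] at h1
    exact h1
  have hc : Continuous fun θ : ℝ ↦ φ x (θ * s) :=
    (Literature.Analysis.ODE.continuous_globalFlow hK hL x).comp (continuous_mul_const s)
  apply IsClosed.Icc_subset_of_forall_mem_nhdsWithin
  · refine IsClosed.inter ?_ isClosed_Icc
    exact (hD.isClosed.preimage hc).inter (isClosed_eq (hρ.continuous.comp hc)
      (continuous_const.add (continuous_mul_const s)))
  · refine ⟨?_, ?_⟩
    · simpa [hφ] using hxD
    · simp [hφ]
  · rintro θ ⟨⟨hθD, hθρ⟩, hθ0, hθ1⟩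
    have hmem : ρ x + θ * s ∈ Icc α β := add_mul_mem_Icc_of_mem_Icc hρx hs ⟨hθ0, hθ1.le⟩
    have hG : φ x (θ * s) ∈ G := hAG ⟨hθD, by rw [hθρ]; exact hmem⟩
    have hev := ((continuous_mul_const s).tendsto θ).eventually (hloc x (θ * s) hG)
    refine mem_nhdsWithin_of_mem_nhds ?_
    filter_upwards [hev] with θ' hθ'
    refine ⟨interior_subset (hGO hθ'.1).1, ?_⟩
    linarith [hθ'.2, hθρ]

end LevelFlow

/-! ### Nondegenerate critical points in a compact set are finite in number -/

section Finite

variable {E : Type*} [NormedAddCommGroup E] [NormedSpace ℝ E] [FiniteDimensional ℝ E]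

/-- **A nondegenerate critical point is isolated** (Milnor, *Morse theory* (1963), Cor. 2.3).
If the Hessian of the `C^∞` function `ρ` at `x` is nondegenerate
(`∀ v ≠ 0, ∃ w, D²ρ(x)(v, w) ≠ 0`), then near `x` no other point has the same differential as
`x` (in particular a nondegenerate critical point is an isolated critical point): `D(dρ)(x)` is
injective, hence bounded below on the finite-dimensional source, while
`dρ(y) - dρ(x) - D(dρ)(x)(y - x) = o(‖y - x‖)`. [cite: MilnorMorseTheory1963, Cor. 2.3] -/
theorem eventually_eq_of_fderiv_eq_of_nondegenerate {ρ : E → ℝ} (hρ : ContDiff ℝ ∞ ρ) {x : E}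
    (hnd : ∀ v : E, v ≠ 0 → ∃ w : E, iteratedFDeriv ℝ 2 ρ x ![v, w] ≠ 0) :
    ∀ᶠ y in 𝓝 x, fderiv ℝ ρ y = fderiv ℝ ρ x → y = x := by
  set L : E →L[ℝ] E →L[ℝ] ℝ := fderiv ℝ (fderiv ℝ ρ) x with hL
  have hDρ : ContDiff ℝ ∞ (fderiv ℝ ρ) := hρ.fderiv_right (m := ∞) (by simp)
  have hLd : HasFDerivAt (fderiv ℝ ρ) L x := (hDρ.differentiable (by simp) x).hasFDerivAt
  have hker : LinearMap.ker (L : E →ₗ[ℝ] E →L[ℝ] ℝ) = ⊥ := by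
    rw [LinearMap.ker_eq_bot']
    intro v hv
    by_contra hv0
    obtain ⟨w, hw⟩ := hnd v hv0
    apply hw
    rw [iteratedFDeriv_two_apply]
    simp only [Matrix.cons_val_zero, Matrix.cons_val_one, Matrix.cons_val_fin_one]
    rw [← hL, show L v = 0 from hv]
    simp
  obtain ⟨k, hk, hanti⟩ := LinearMap.exists_antilipschitzWith (L : E →ₗ[ℝ] E →L[ℝ] ℝ) hker
  have hk' : (0 : ℝ) < k := hk
  have hsmall := hLd.isLittleO.def (show (0 : ℝ) < 1 / (2 * k) by positivity)
  filter_upwards [hsmall] with y hy hyx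
  rw [hyx, sub_self, zero_sub, norm_neg] at hy
  have h1 : ‖y - x‖ ≤ k * ‖L (y - x)‖ := by
    have := hanti.le_mul_dist (y - x) 0
    simpa [dist_eq_norm] using this
  have h2 : ‖y - x‖ ≤ ‖y - x‖ / 2 := by
    calc ‖y - x‖ ≤ k * ‖L (y - x)‖ := h1
      _ ≤ k * (1 / (2 * k) * ‖y - x‖) := by gcongr
      _ = ‖y - x‖ / 2 := by field_simp
  have h3 : ‖y - x‖ = 0 := by linarith [norm_nonneg (y - x)]
  rwa [norm_eq_zero, sub_eq_zero] at h3

/-- **Nondegenerate critical points in a compact set are finite in number** (Milnor, *Morse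
theory* (1963), Cor. 2.3). If every critical point of the `C^∞` function `ρ` in the compact set
`C` is nondegenerate, then `ρ` has finitely many critical points in `C` (they form a closed
subset of `C` all of whose points are isolated, so it has no accumulation point).
[cite: MilnorMorseTheory1963, Cor. 2.3] -/
theorem finite_setOf_fderiv_eq_zero_of_nondegenerate {ρ : E → ℝ} (hρ : ContDiff ℝ ∞ ρ)
    {C : Set E} (hC : IsCompact C)
    (hnd : ∀ x ∈ C, fderiv ℝ ρ x = 0 → ∀ v : E, v ≠ 0 →
      ∃ w : E, iteratedFDeriv ℝ 2 ρ x ![v, w] ≠ 0) :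
    {x ∈ C | fderiv ℝ ρ x = 0}.Finite := by
  set Z : Set E := {x ∈ C | fderiv ℝ ρ x = 0} with hZ
  have hZc : IsClosed Z :=
    hC.isClosed.inter (isClosed_eq (hρ.continuous_fderiv (by simp)) continuous_const)
  by_contra hinf
  obtain ⟨x, -, hacc⟩ := Set.Infinite.exists_accPt_of_subset_isCompact hinf hC (fun y hy ↦ hy.1)
  have hxZ : x ∈ Z := by
    rw [← hZc.closure_eq, mem_closure_iff_clusterPt]
    exact hacc.clusterPt
  have hiso := eventually_eq_of_fderiv_eq_of_nondegenerate hρ (hnd x hxZ.1 hxZ.2)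
  rw [accPt_iff_frequently] at hacc
  obtain ⟨y, ⟨hne, hyZ⟩, hy⟩ := (hacc.and_eventually hiso).exists
  exact hne (hy (hyZ.2.trans hxZ.2.symm))

end Finite

/-! ### The retardation profile `τ` and the radial factor `σ = √(t / τ t)` -/

section Profile

/-- **Retardation profile for one product interval.** For `0 < α < a ≤ b < β` there are `C^∞`
functions `τ σ : ℝ → ℝ` with: `τ t = t` and `σ t = 1` off `(α, β)`; `τ ≡ a` on `[a, b]`;
`τ` maps `[α, β]` into itself; `σ > 0`, `σ² τ = id` on `[0, ∞)` and `σ t = √(t / τ t)` for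
`t > 0`. (`τ t = t + B t (a - t)` for a smooth bump `B` equal to `1` on `[a, b]` and supported
in `[α, β]` — Mathlib's `ContDiffBump` on `ℝ` —, and `σ = √(1 - B (a - t) / τ)`, which is `1`
near `t ≤ 0`.) [folklore] -/
theorem exists_retardation_profile {α a b β : ℝ} (hα : 0 < α) (hαa : α < a) (hab : a ≤ b)
    (hbβ : b < β) :
    ∃ τ σ : ℝ → ℝ, ContDiff ℝ ∞ τ ∧ ContDiff ℝ ∞ σ ∧
      (∀ t, t ∉ Ioo α β → τ t = t ∧ σ t = 1) ∧
      (∀ t ∈ Icc a b, τ t = a) ∧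
      (∀ t ∈ Icc α β, τ t ∈ Icc α β) ∧
      (∀ t, 0 < σ t) ∧
      (∀ t, 0 ≤ t → σ t ^ 2 * τ t = t) ∧
      (∀ t, 0 < t → σ t = Real.sqrt (t / τ t)) := by
  set m : ℝ := (a + b) / 2 with hm
  set ε : ℝ := min (a - α) (β - b) with hε
  have hε0 : 0 < ε := lt_min (by linarith) (by linarith)
  have hεa : ε ≤ a - α := min_le_left _ _
  have hεb : ε ≤ β - b := min_le_right _ _
  let B : ContDiffBump m := ⟨(b - a) / 2 + ε / 2, (b - a) / 2 + ε, by linarith, by linarith⟩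
  have hBs : ContDiff ℝ ∞ B := B.contDiff
  have hB1 : ∀ t ∈ Icc a b, B t = 1 := fun t ht ↦ by
    apply B.one_of_mem_closedBall
    rw [mem_closedBall]
    show dist t m ≤ (b - a) / 2 + ε / 2
    rw [Real.dist_eq, abs_le]
    constructor <;> linarith [ht.1, ht.2]
  have hB0 : ∀ t, t ∉ Ioo α β → B t = 0 := fun t ht ↦ by
    apply B.zero_of_le_dist
    rw [Real.dist_eq]
    show (b - a) / 2 + ε ≤ |t - m|
    rw [mem_Ioo, not_and_or, not_lt, not_lt] at ht
    rcases ht with ht | ht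
    · rw [abs_of_nonpos (by linarith)]
      linarith
    · rw [abs_of_nonneg (by linarith)]
      linarith
  have hB01 : ∀ t, 0 ≤ B t ∧ B t ≤ 1 := fun t ↦ ⟨B.nonneg, B.le_one⟩
  set τ : ℝ → ℝ := fun t ↦ t + B t * (a - t) with hτ
  have hτs : ContDiff ℝ ∞ τ := contDiff_id.add (hBs.mul (contDiff_const.sub contDiff_id))
  have hτid : ∀ t, t ∉ Ioo α β → τ t = t := fun t ht ↦ by simp [hτ, hB0 t ht]
  have hτab : ∀ t ∈ Icc a b, τ t = a := fun t ht ↦ by simp [hτ, hB1 t ht]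
  have hτm : ∀ t ∈ Icc α β, τ t ∈ Icc α β := fun t ht ↦ by
    obtain ⟨h0, h1⟩ := hB01 t
    simp only [hτ, mem_Icc]
    constructor <;> nlinarith [ht.1, ht.2, mul_nonneg h0 (sub_nonneg.2 hαa.le),
      mul_nonneg (sub_nonneg.2 h1) (sub_nonneg.2 ht.1), mul_nonneg h0 (show 0 ≤ β - a by linarith),
      mul_nonneg (sub_nonneg.2 h1) (sub_nonneg.2 ht.2)]
  have hτpos : ∀ t, 0 < t → 0 < τ t := fun t ht ↦ by
    by_cases h : t ∈ Ioo α β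
    · exact hα.trans_le (hτm t (Ioo_subset_Icc_self h)).1
    · rw [hτid t h]; exact ht
  have hτ0 : ∀ t, τ t = 0 → t = 0 := fun t ht ↦ by
    by_cases h : t ∈ Ioo α β
    · exact absurd ht (hτpos t (hα.trans h.1)).ne'
    · rw [← hτid t h]; exact ht
  set θ : ℝ → ℝ := fun t ↦ 1 - B t * (a - t) / τ t with hθ
  have hθ1 : ∀ t, t ∉ Ioo α β → θ t = 1 := fun t ht ↦ by simp [hθ, hB0 t ht]
  have hθeq : ∀ t, τ t ≠ 0 → θ t = t / τ t := fun t ht ↦ by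
    simp only [hθ, hτ] at ht ⊢
    field_simp
    ring
  have hθpos : ∀ t, 0 < θ t := fun t ↦ by
    by_cases h : t ∈ Ioo α β
    · have ht : 0 < t := hα.trans h.1
      rw [hθeq t (hτpos t ht).ne']
      exact div_pos ht (hτpos t ht)
    · rw [hθ1 t h]; exact one_pos
  have hθs : ContDiff ℝ ∞ θ := by
    refine contDiff_iff_contDiffAt.2 fun t ↦ ?_
    by_cases ht : τ t = 0
    · have ht0 : t = 0 := hτ0 t ht
      have hev : θ =ᶠ[𝓝 t] fun _ ↦ 1 := by
        have : ∀ᶠ u in 𝓝 t, u < α := by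
          rw [ht0]; exact Iio_mem_nhds hα
        filter_upwards [this] with u hu
        exact hθ1 u fun h ↦ (lt_irrefl _ (hu.trans h.1))
      exact contDiffAt_const.congr_of_eventuallyEq hev
    · exact contDiffAt_const.sub
        ((hBs.contDiffAt.mul (contDiffAt_const.sub contDiffAt_id)).div hτs.contDiffAt ht)
  set σ : ℝ → ℝ := fun t ↦ Real.sqrt (θ t) with hσ
  have hσs : ContDiff ℝ ∞ σ := hθs.sqrt fun t ↦ (hθpos t).ne'
  refine ⟨τ, σ, hτs, hσs, fun t ht ↦ ⟨hτid t ht, by simp [hσ, hθ1 t ht]⟩, hτab, hτm,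
    fun t ↦ Real.sqrt_pos.2 (hθpos t), fun t ht ↦ ?_, fun t ht ↦ ?_⟩
  · simp only [hσ]
    rw [Real.sq_sqrt (hθpos t).le]
    by_cases h : τ t = 0
    · rw [h, mul_zero, hτ0 t h]
    · rw [hθeq t h]
      field_simp
  · simp only [hσ]
    rw [hθeq t (hτpos t ht).ne']

end Profile

/-! ### The radial reparametrisation of a disc along a level-raising flow -/

section Reparam

variable {g : EuclideanSpace ℝ (Fin 2) → EuclideanSpace ℝ (Fin 4)} {τ σ : ℝ → ℝ}
  {φ : EuclideanSpace ℝ (Fin 2) → ℝ → EuclideanSpace ℝ (Fin 2)} {α β : ℝ}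

/-- The **radial reparametrisation** `x ↦ σ(ρ x) • g(φ_{τ(ρ x) - ρ x}(x))` of a disc `g`
(`ρ = ‖g‖²`) along a flow `φ` with retardation `τ` and radial factor `σ`: the point `x` on
level `ρ x` is first pushed by the flow to the level `τ(ρ x)` and its image is then rescaled back
to the sphere of radius `√(ρ x)` (Milnor's product structure between regular levels, read
radially). [cite: MilnorMorseTheory1963, §3 Thm. 3.1] -/
private def radialProductReparam (g : EuclideanSpace ℝ (Fin 2) → EuclideanSpace ℝ (Fin 4))
    (τ σ : ℝ → ℝ) (φ : EuclideanSpace ℝ (Fin 2) → ℝ → EuclideanSpace ℝ (Fin 2)) :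
    EuclideanSpace ℝ (Fin 2) → EuclideanSpace ℝ (Fin 4) :=
  fun x ↦ σ (‖g x‖ ^ 2) • g (φ x (τ (‖g x‖ ^ 2) - ‖g x‖ ^ 2))

/-- The pushed point `φ_{τ(ρ x) - ρ x}(x)` of a point of the closed disc lies in the closed
disc, on the level `τ(ρ x)` (the level identity of the flow if `ρ x ∈ [α, β]`; no motion
otherwise). [folklore] -/
private theorem radialProductReparam_push_mem (hφ0 : ∀ x, φ x 0 = x)
    (hid : ∀ t, t ∉ Ioo α β → τ t = t ∧ σ t = 1) (hτm : ∀ t ∈ Icc α β, τ t ∈ Icc α β)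
    (hlev : ∀ x : EuclideanSpace ℝ (Fin 2), ‖x‖ ≤ 1 → ‖g x‖ ^ 2 ∈ Icc α β → ∀ s : ℝ,
      ‖g x‖ ^ 2 + s ∈ Icc α β → ‖φ x s‖ ≤ 1 ∧ ‖g (φ x s)‖ ^ 2 = ‖g x‖ ^ 2 + s)
    {x : EuclideanSpace ℝ (Fin 2)} (hx : ‖x‖ ≤ 1) :
    ‖φ x (τ (‖g x‖ ^ 2) - ‖g x‖ ^ 2)‖ ≤ 1 ∧
      ‖g (φ x (τ (‖g x‖ ^ 2) - ‖g x‖ ^ 2))‖ ^ 2 = τ (‖g x‖ ^ 2) := by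
  by_cases h : ‖g x‖ ^ 2 ∈ Ioo α β
  · have h' := Ioo_subset_Icc_self h
    have key := hlev x hx h' (τ (‖g x‖ ^ 2) - ‖g x‖ ^ 2) (by rw [add_sub_cancel]; exact hτm _ h')
    rwa [add_sub_cancel] at key
  · rw [(hid _ h).1, sub_self, hφ0]
    exact ⟨hx, rfl⟩

/-- **The reparametrised disc has the same radius function** on the closed disc:
`‖g' x‖² = σ(ρ x)² τ(ρ x) = ρ x`. [folklore] -/
private theorem norm_radialProductReparam_sq (hφ0 : ∀ x, φ x 0 = x)
    (hid : ∀ t, t ∉ Ioo α β → τ t = t ∧ σ t = 1) (hτm : ∀ t ∈ Icc α β, τ t ∈ Icc α β)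
    (hστ : ∀ t, 0 ≤ t → σ t ^ 2 * τ t = t)
    (hlev : ∀ x : EuclideanSpace ℝ (Fin 2), ‖x‖ ≤ 1 → ‖g x‖ ^ 2 ∈ Icc α β → ∀ s : ℝ,
      ‖g x‖ ^ 2 + s ∈ Icc α β → ‖φ x s‖ ≤ 1 ∧ ‖g (φ x s)‖ ^ 2 = ‖g x‖ ^ 2 + s)
    {x : EuclideanSpace ℝ (Fin 2)} (hx : ‖x‖ ≤ 1) :
    ‖radialProductReparam g τ σ φ x‖ ^ 2 = ‖g x‖ ^ 2 := by
  simp only [radialProductReparam]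
  rw [norm_smul, mul_pow, Real.norm_eq_abs, sq_abs,
    (radialProductReparam_push_mem hφ0 hid hτm hlev hx).2, hστ _ (sq_nonneg _)]

/-- Where the radius is outside the modified range `(α, β)`, the reparametrised disc is the
original one. [folklore] -/
private theorem radialProductReparam_eq_self (hφ0 : ∀ x, φ x 0 = x)
    (hid : ∀ t, t ∉ Ioo α β → τ t = t ∧ σ t = 1) {x : EuclideanSpace ℝ (Fin 2)}
    (hx : ‖g x‖ ^ 2 ∉ Ioo α β) : radialProductReparam g τ σ φ x = g x := by
  simp only [radialProductReparam]
  rw [(hid _ hx).1, (hid _ hx).2, sub_self, hφ0, one_smul]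

/-- Near a point of radius-squared `> β` (e.g. a point of the boundary circle, when `β < 1`)
the reparametrised disc coincides with the original one. [folklore] -/
private theorem radialProductReparam_eventuallyEq (hgc : Continuous g) (hφ0 : ∀ x, φ x 0 = x)
    (hid : ∀ t, t ∉ Ioo α β → τ t = t ∧ σ t = 1) {x : EuclideanSpace ℝ (Fin 2)}
    (hx : β < ‖g x‖ ^ 2) : radialProductReparam g τ σ φ =ᶠ[𝓝 x] g := by
  have hc : Continuous fun y ↦ ‖g y‖ ^ 2 := (hgc.norm).pow 2
  have : ∀ᶠ y in 𝓝 x, β < ‖g y‖ ^ 2 := (hc.tendsto x).eventually (lt_mem_nhds hx)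
  filter_upwards [this] with y hy
  exact radialProductReparam_eq_self hφ0 hid fun h ↦ lt_irrefl _ (hy.trans h.2)

/-- **The radius function is unchanged near every point of the closed disc** (so critical
points, critical values, Hessians and the neatness derivative are unchanged). [folklore] -/
private theorem norm_radialProductReparam_sq_eventuallyEq (hgc : Continuous g) (hβ : β < 1)
    (hbd : ∀ x : EuclideanSpace ℝ (Fin 2), ‖x‖ = 1 → ‖g x‖ = 1) (hφ0 : ∀ x, φ x 0 = x)
    (hid : ∀ t, t ∉ Ioo α β → τ t = t ∧ σ t = 1) (hτm : ∀ t ∈ Icc α β, τ t ∈ Icc α β)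
    (hστ : ∀ t, 0 ≤ t → σ t ^ 2 * τ t = t)
    (hlev : ∀ x : EuclideanSpace ℝ (Fin 2), ‖x‖ ≤ 1 → ‖g x‖ ^ 2 ∈ Icc α β → ∀ s : ℝ,
      ‖g x‖ ^ 2 + s ∈ Icc α β → ‖φ x s‖ ≤ 1 ∧ ‖g (φ x s)‖ ^ 2 = ‖g x‖ ^ 2 + s)
    {x : EuclideanSpace ℝ (Fin 2)} (hx : ‖x‖ ≤ 1) :
    (fun y ↦ ‖radialProductReparam g τ σ φ y‖ ^ 2) =ᶠ[𝓝 x] fun y ↦ ‖g y‖ ^ 2 := by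
  rcases hx.lt_or_eq with hx1 | hx1
  · have : ∀ᶠ y in 𝓝 x, ‖y‖ < 1 := (continuous_norm.tendsto x).eventually (gt_mem_nhds hx1)
    filter_upwards [this] with y hy
    exact norm_radialProductReparam_sq hφ0 hid hτm hστ hlev hy.le
  · have h1 : β < ‖g x‖ ^ 2 := by rw [hbd x hx1, one_pow]; exact hβ
    filter_upwards [radialProductReparam_eventuallyEq hgc hφ0 hid h1] with y hy
    rw [hy]

/-- The reparametrised disc is `C^∞` (composition of smooth maps). [folklore] -/
private theorem contDiff_radialProductReparam (hgs : ContDiff ℝ ∞ g) (hτ : ContDiff ℝ ∞ τ)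
    (hσ : ContDiff ℝ ∞ σ) (hφs : ContDiff ℝ ∞ fun p : EuclideanSpace ℝ (Fin 2) × ℝ ↦ φ p.1 p.2) :
    ContDiff ℝ ∞ (radialProductReparam g τ σ φ) := by
  have hρ : ContDiff ℝ ∞ fun y ↦ ‖g y‖ ^ 2 := hgs.norm_sq ℝ
  have hψ : ContDiff ℝ ∞ fun y ↦ φ y (τ (‖g y‖ ^ 2) - ‖g y‖ ^ 2) :=
    hφs.comp (contDiff_id.prodMk ((hτ.comp hρ).sub hρ))
  exact (hσ.comp hρ).smul (hgs.comp hψ)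

/-- **The reparametrised disc is injective on the closed disc**: equal images have equal radius,
hence come from the same level, on which `g ∘ φₛ` is injective. [folklore] -/
private theorem injOn_radialProductReparam (hinj : InjOn g (closedBall 0 1)) (hφ0 : ∀ x, φ x 0 = x)
    (hφinv : ∀ x s, φ (φ x s) (-s) = x)
    (hid : ∀ t, t ∉ Ioo α β → τ t = t ∧ σ t = 1) (hτm : ∀ t ∈ Icc α β, τ t ∈ Icc α β)
    (hσpos : ∀ t, 0 < σ t) (hστ : ∀ t, 0 ≤ t → σ t ^ 2 * τ t = t)
    (hlev : ∀ x : EuclideanSpace ℝ (Fin 2), ‖x‖ ≤ 1 → ‖g x‖ ^ 2 ∈ Icc α β → ∀ s : ℝ,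
      ‖g x‖ ^ 2 + s ∈ Icc α β → ‖φ x s‖ ≤ 1 ∧ ‖g (φ x s)‖ ^ 2 = ‖g x‖ ^ 2 + s) :
    InjOn (radialProductReparam g τ σ φ) (closedBall 0 1) := by
  intro x hx y hy hxy
  rw [mem_closedBall_zero_iff] at hx hy
  have hρ : ‖g x‖ ^ 2 = ‖g y‖ ^ 2 := by
    rw [← norm_radialProductReparam_sq hφ0 hid hτm hστ hlev hx,
      ← norm_radialProductReparam_sq hφ0 hid hτm hστ hlev hy, hxy]
  obtain ⟨hxm, -⟩ := radialProductReparam_push_mem hφ0 hid hτm hlev hx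
  obtain ⟨hym, -⟩ := radialProductReparam_push_mem hφ0 hid hτm hlev hy
  simp only [radialProductReparam] at hxy
  rw [hρ] at hxy hxm
  have h1 := smul_right_injective (EuclideanSpace ℝ (Fin 4)) (hσpos _).ne' hxy
  have h2 := hinj (mem_closedBall_zero_iff.2 hxm) (mem_closedBall_zero_iff.2 hym) h1
  rw [← hφinv x (τ (‖g y‖ ^ 2) - ‖g y‖ ^ 2), h2, hφinv]

/-- **The reparametrised disc is an immersion on the closed disc.** Near the boundary circle it
equals `g`. At an interior point, a kernel vector `v` of `Dg'(x)` satisfies `dρ(v) = 0`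
(differentiate `‖g'‖² = ρ`), so `Dg'(x) v = σ(ρ x) • Dg(Dφₛ(x) v)` with `Dg` injective on the
disc and `Dφₛ(x)` invertible (`φ₋ₛ ∘ φₛ = id`). [folklore] -/
private theorem injective_fderiv_radialProductReparam (hgs : ContDiff ℝ ∞ g) (hτ : ContDiff ℝ ∞ τ)
    (hσ : ContDiff ℝ ∞ σ) (hφs : ContDiff ℝ ∞ fun p : EuclideanSpace ℝ (Fin 2) × ℝ ↦ φ p.1 p.2)
    (himm : ∀ x ∈ closedBall (0 : EuclideanSpace ℝ (Fin 2)) 1, Injective (fderiv ℝ g x))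
    (hβ : β < 1) (hbd : ∀ x : EuclideanSpace ℝ (Fin 2), ‖x‖ = 1 → ‖g x‖ = 1)
    (hφ0 : ∀ x, φ x 0 = x) (hφinv : ∀ x s, φ (φ x s) (-s) = x)
    (hid : ∀ t, t ∉ Ioo α β → τ t = t ∧ σ t = 1) (hτm : ∀ t ∈ Icc α β, τ t ∈ Icc α β)
    (hσpos : ∀ t, 0 < σ t) (hστ : ∀ t, 0 ≤ t → σ t ^ 2 * τ t = t)
    (hlev : ∀ x : EuclideanSpace ℝ (Fin 2), ‖x‖ ≤ 1 → ‖g x‖ ^ 2 ∈ Icc α β → ∀ s : ℝ,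
      ‖g x‖ ^ 2 + s ∈ Icc α β → ‖φ x s‖ ≤ 1 ∧ ‖g (φ x s)‖ ^ 2 = ‖g x‖ ^ 2 + s)
    {x : EuclideanSpace ℝ (Fin 2)} (hx : ‖x‖ ≤ 1) :
    Injective (fderiv ℝ (radialProductReparam g τ σ φ) x) := by
  rcases hx.lt_or_eq with hx1 | hx1
  swap
  · -- a boundary point: `g' = g` nearby
    have h1 : β < ‖g x‖ ^ 2 := by rw [hbd x hx1, one_pow]; exact hβ
    rw [(radialProductReparam_eventuallyEq hgs.continuous hφ0 hid h1).fderiv_eq]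
    exact himm x (mem_closedBall_zero_iff.2 hx)
  -- an interior point
  set ρ : EuclideanSpace ℝ (Fin 2) → ℝ := fun y ↦ ‖g y‖ ^ 2 with hρdef
  set s : ℝ := τ (ρ x) - ρ x with hsdef
  set Φ : EuclideanSpace ℝ (Fin 2) × ℝ → EuclideanSpace ℝ (Fin 2) := fun p ↦ φ p.1 p.2 with hΦdef
  set k : ℝ → ℝ := fun t ↦ τ t - t with hkdef
  set ψ : EuclideanSpace ℝ (Fin 2) → EuclideanSpace ℝ (Fin 2) := fun y ↦ φ y (τ (ρ y) - ρ y)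
    with hψdef
  have hρs : ContDiff ℝ ∞ ρ := hgs.norm_sq ℝ
  have hρd : DifferentiableAt ℝ ρ x := hρs.differentiable (by simp) x
  have hk : ContDiff ℝ ∞ k := hτ.sub contDiff_id
  have hm : HasFDerivAt (fun y ↦ k (ρ y)) ((fderiv ℝ k (ρ x)).comp (fderiv ℝ ρ x)) x :=
    ((hk.differentiable (by simp)) _).hasFDerivAt.comp x hρd.hasFDerivAt
  have hpair : HasFDerivAt (fun y ↦ (y, k (ρ y)))
      ((ContinuousLinearMap.id ℝ (EuclideanSpace ℝ (Fin 2))).prod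
        ((fderiv ℝ k (ρ x)).comp (fderiv ℝ ρ x))) x :=
    (hasFDerivAt_id x).prodMk hm
  have hΦd : DifferentiableAt ℝ Φ (x, s) := hφs.differentiable (by simp) _
  have hψ : HasFDerivAt ψ ((fderiv ℝ Φ (x, s)).comp
      ((ContinuousLinearMap.id ℝ (EuclideanSpace ℝ (Fin 2))).prod
        ((fderiv ℝ k (ρ x)).comp (fderiv ℝ ρ x)))) x := by
    have h := hΦd.hasFDerivAt.comp x hpair
    exact h
  -- the time-`s` map and its left inverse, the time-`(-s)` map
  have hflow : HasFDerivAt (fun y ↦ φ y s)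
      ((fderiv ℝ Φ (x, s)).comp (ContinuousLinearMap.inl ℝ (EuclideanSpace ℝ (Fin 2)) ℝ)) x := by
    have h := hΦd.hasFDerivAt.comp x (hasFDerivAt_prodMk_left (𝕜 := ℝ) x s)
    exact h
  have hinvd : DifferentiableAt ℝ (fun z ↦ φ z (-s)) (φ x s) := by
    have h : DifferentiableAt ℝ Φ (φ x s, -s) := hφs.differentiable (by simp) _
    have h2 := h.hasFDerivAt.comp (φ x s) (hasFDerivAt_prodMk_left (𝕜 := ℝ) (φ x s) (-s))
    exact h2.differentiableAt
  have hcomp : (fderiv ℝ (fun z ↦ φ z (-s)) (φ x s)).comp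
      ((fderiv ℝ Φ (x, s)).comp (ContinuousLinearMap.inl ℝ (EuclideanSpace ℝ (Fin 2)) ℝ)) =
      ContinuousLinearMap.id ℝ (EuclideanSpace ℝ (Fin 2)) := by
    have h := hinvd.hasFDerivAt.comp x hflow
    have hid' : ((fun z ↦ φ z (-s)) ∘ fun y ↦ φ y s) = id := funext fun y ↦ hφinv y s
    rw [hid'] at h
    exact h.unique (hasFDerivAt_id x)
  refine (injective_iff_map_eq_zero _).2 fun v hv ↦ ?_
  have hψx : ‖ψ x‖ ≤ 1 := (radialProductReparam_push_mem hφ0 hid hτm hlev hx).1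
  -- Step 1: `v` is tangent to the level, `dρ(v) = 0`
  have hρ' :=
    norm_radialProductReparam_sq_eventuallyEq hgs.continuous hβ hbd hφ0 hid hτm hστ hlev hx
  have hg'd : DifferentiableAt ℝ (radialProductReparam g τ σ φ) x :=
    (contDiff_radialProductReparam hgs hτ hσ hφs).differentiable (by simp) x
  have hdρv : fderiv ℝ ρ x v = 0 := by
    have h := hg'd.hasFDerivAt.norm_sq.fderiv
    rw [hρ'.fderiv_eq] at h
    rw [h]
    simp [hv]
  -- Step 2: the differential of `g' = (σ ∘ ρ) • (g ∘ ψ)` on `v`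
  have h1 : HasFDerivAt (fun y ↦ σ (ρ y)) ((fderiv ℝ σ (ρ x)).comp (fderiv ℝ ρ x)) x :=
    ((hσ.differentiable (by simp)) _).hasFDerivAt.comp x hρd.hasFDerivAt
  have h2 : HasFDerivAt (fun y ↦ g (ψ y)) ((fderiv ℝ g (ψ x)).comp (fderiv ℝ ψ x)) x :=
    ((hgs.differentiable (by simp)) _).hasFDerivAt.comp x hψ.differentiableAt.hasFDerivAt
  have h3 : HasFDerivAt (radialProductReparam g τ σ φ)
      (σ (ρ x) • ((fderiv ℝ g (ψ x)).comp (fderiv ℝ ψ x)) +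
        ((fderiv ℝ σ (ρ x)).comp (fderiv ℝ ρ x)).smulRight (g (ψ x))) x :=
    h1.smul h2
  have h4 : fderiv ℝ (radialProductReparam g τ σ φ) x v =
      σ (ρ x) • fderiv ℝ g (ψ x) (fderiv ℝ ψ x v) := by
    rw [h3.fderiv]
    simp [hdρv]
  have h5 : fderiv ℝ ψ x v = fderiv ℝ Φ (x, s) (v, 0) := by
    rw [hψ.fderiv]
    simp [hdρv]
  rw [h4, h5] at hv
  have h6 : fderiv ℝ g (ψ x) (fderiv ℝ Φ (x, s) (v, 0)) = 0 := by
    rcases smul_eq_zero.1 hv with h | h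
    · exact absurd h (hσpos _).ne'
    · exact h
  have h7 : fderiv ℝ Φ (x, s) (v, 0) = 0 :=
    (injective_iff_map_eq_zero _).1 (himm (ψ x) (mem_closedBall_zero_iff.2 hψx)) _ h6
  have h8 := congrArg (fun T : EuclideanSpace ℝ (Fin 2) →L[ℝ] EuclideanSpace ℝ (Fin 2) ↦ T v) hcomp
  simp only [ContinuousLinearMap.comp_apply, ContinuousLinearMap.inl_apply,
    ContinuousLinearMap.id_apply] at h8
  rw [h7, map_zero] at h8
  exact h8.symm

/-- **Levels of the reparametrised disc**: for `t ∈ [α, β]`, level `t` of `g'` over the closed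
disc is `σ t •` (level `τ t` of `g` over the closed disc) — `⊆` by the level identity of the
flow, `⊇` by flowing back from level `τ t` to level `t`.
[cite: MilnorMorseTheory1963, §3 Thm. 3.1] -/
private theorem level_radialProductReparam (hφ0 : ∀ x, φ x 0 = x)
    (hφinv : ∀ x s, φ (φ x s) (-s) = x)
    (hid : ∀ t, t ∉ Ioo α β → τ t = t ∧ σ t = 1) (hτm : ∀ t ∈ Icc α β, τ t ∈ Icc α β)
    (hστ : ∀ t, 0 ≤ t → σ t ^ 2 * τ t = t)
    (hlev : ∀ x : EuclideanSpace ℝ (Fin 2), ‖x‖ ≤ 1 → ‖g x‖ ^ 2 ∈ Icc α β → ∀ s : ℝ,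
      ‖g x‖ ^ 2 + s ∈ Icc α β → ‖φ x s‖ ≤ 1 ∧ ‖g (φ x s)‖ ^ 2 = ‖g x‖ ^ 2 + s)
    {t : ℝ} (ht : t ∈ Icc α β) :
    {p | ∃ x, ‖x‖ ≤ 1 ∧ radialProductReparam g τ σ φ x = p ∧
        ‖radialProductReparam g τ σ φ x‖ ^ 2 = t} =
      σ t • (g '' {y | ‖y‖ ≤ 1 ∧ ‖g y‖ ^ 2 = τ t}) := by
  ext p
  simp only [mem_setOf_eq, mem_smul_set, mem_image]
  constructor
  · rintro ⟨x, hx, rfl, hxt⟩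
    rw [norm_radialProductReparam_sq hφ0 hid hτm hστ hlev hx] at hxt
    obtain ⟨hm, hρm⟩ := radialProductReparam_push_mem hφ0 hid hτm hlev hx
    refine ⟨g (φ x (τ (‖g x‖ ^ 2) - ‖g x‖ ^ 2)), ⟨_, ⟨hm, by rw [hρm, hxt]⟩, rfl⟩, ?_⟩
    simp only [radialProductReparam, hxt]
  · rintro ⟨q, ⟨y, ⟨hy, hyt⟩, rfl⟩, rfl⟩
    have hτt : τ t ∈ Icc α β := hτm t ht
    obtain ⟨hxD, hρx⟩ := hlev y hy (by rw [hyt]; exact hτt) (t - τ t)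
      (by rw [hyt, add_sub_cancel]; exact ht)
    rw [hyt, add_sub_cancel] at hρx
    refine ⟨φ y (t - τ t), hxD, ?_,
      by rw [norm_radialProductReparam_sq hφ0 hid hτm hστ hlev hxD, hρx]⟩
    simp only [radialProductReparam, hρx]
    rw [show τ t - t = -(t - τ t) by ring, hφinv]

end Reparam

/-! ### One product interval -/

/-- **Straightening one product interval.** Let `g` be a slice disc of `K` and
`0 < α < a ≤ b < β < 1` such that `ρ = ‖g‖²` has no critical point on `ρ⁻¹[α, β] ∩ 𝔻²`. Then
there is a slice disc `g'` of `K` with the same radius function near every point of `𝔻²`, equal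
to `g` wherever `ρ ∉ (α, β)`, and whose level links over `𝔻²` are radially constant on
`[a, b]`: `level t' = √(t'/t) • level t` for `t, t' ∈ [a, b]`. (`g' = radialProductReparam g τ σ φ`
for the flow of `exists_flow_apply_level_eq_add` and the profile of
`exists_retardation_profile`; Milnor, *Morse theory* (1963), Thm. 3.1, read radially.)
[cite: MilnorMorseTheory1963, §3 Thm. 3.1] -/
theorem Knot.IsSliceDisc.exists_isSliceDisc_radialProduct_step {K : Knot}
    {g : EuclideanSpace ℝ (Fin 2) → EuclideanSpace ℝ (Fin 4)} (hg : K.IsSliceDisc g)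
    {α a b β : ℝ} (hα : 0 < α) (hαa : α < a) (hab : a ≤ b) (hbβ : b < β) (hβ : β < 1)
    (hreg : ∀ x : EuclideanSpace ℝ (Fin 2), ‖x‖ ≤ 1 → ‖g x‖ ^ 2 ∈ Icc α β →
      fderiv ℝ (fun y ↦ ‖g y‖ ^ 2) x ≠ 0) :
    ∃ g' : EuclideanSpace ℝ (Fin 2) → EuclideanSpace ℝ (Fin 4), K.IsSliceDisc g' ∧
      (∀ x : EuclideanSpace ℝ (Fin 2), ‖x‖ ≤ 1 →
        (fun y ↦ ‖g' y‖ ^ 2) =ᶠ[𝓝 x] fun y ↦ ‖g y‖ ^ 2) ∧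
      (∀ x : EuclideanSpace ℝ (Fin 2), ‖g x‖ ^ 2 ∉ Ioo α β → g' x = g x) ∧
      ∀ t ∈ Icc a b, ∀ t' ∈ Icc a b,
        {p | ∃ x, ‖x‖ ≤ 1 ∧ g' x = p ∧ ‖g' x‖ ^ 2 = t'} =
          Real.sqrt (t' / t) • {p | ∃ x, ‖x‖ ≤ 1 ∧ g' x = p ∧ ‖g' x‖ ^ 2 = t} := by
  obtain ⟨hgs, hginj, hgimm, hgint, hgneat, hgK⟩ := hg
  have hbd : ∀ x : EuclideanSpace ℝ (Fin 2), ‖x‖ = 1 → ‖g x‖ = 1 := fun x hx ↦ by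
    rw [show g x = _ from hgK ⟨x, by rwa [mem_sphere_zero_iff_norm]⟩, norm_eq_of_mem_sphere]
  have hρs : ContDiff ℝ ∞ fun y ↦ ‖g y‖ ^ 2 := hgs.norm_sq ℝ
  -- the level-raising flow on the slab `ρ⁻¹[α, β] ∩ 𝔻²`
  have hint : ∀ x ∈ closedBall (0 : EuclideanSpace ℝ (Fin 2)) 1, ‖g x‖ ^ 2 ∈ Icc α β →
      x ∈ interior (closedBall (0 : EuclideanSpace ℝ (Fin 2)) 1) := by
    intro x hx hρx
    rw [interior_closedBall 0 one_ne_zero, mem_ball_zero_iff]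
    rw [mem_closedBall_zero_iff] at hx
    refine lt_of_le_of_ne hx fun h ↦ ?_
    have : ‖g x‖ ^ 2 = 1 := by rw [hbd x h, one_pow]
    linarith [hρx.2]
  obtain ⟨φ, hφs, hφ0, hφadd, hlev⟩ := exists_flow_apply_level_eq_add hρs
    (isCompact_closedBall (0 : EuclideanSpace ℝ (Fin 2)) 1) hint
    (fun x hx hρx ↦ hreg x (mem_closedBall_zero_iff.1 hx) hρx)
  have hφinv : ∀ x s, φ (φ x s) (-s) = x := fun x s ↦ by rw [← hφadd, add_neg_cancel, hφ0]
  have hlev' : ∀ x : EuclideanSpace ℝ (Fin 2), ‖x‖ ≤ 1 → ‖g x‖ ^ 2 ∈ Icc α β → ∀ s : ℝ,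
      ‖g x‖ ^ 2 + s ∈ Icc α β → ‖φ x s‖ ≤ 1 ∧ ‖g (φ x s)‖ ^ 2 = ‖g x‖ ^ 2 + s :=
    fun x hx h s hs ↦ by
      have key := hlev x (mem_closedBall_zero_iff.2 hx) h s hs
      exact ⟨mem_closedBall_zero_iff.1 key.1, key.2⟩
  -- the retardation profile
  obtain ⟨τ, σ, hτs, hσs, hid, hτa, hτm, hσpos, hστ, hσeq⟩ :=
    exists_retardation_profile hα hαa hab hbβ
  refine ⟨radialProductReparam g τ σ φ, ⟨contDiff_radialProductReparam hgs hτs hσs hφs,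
    injOn_radialProductReparam hginj hφ0 hφinv hid hτm hσpos hστ hlev',
    fun x hx ↦ injective_fderiv_radialProductReparam hgs hτs hσs hφs hgimm hβ hbd hφ0 hφinv hid hτm
      hσpos hστ hlev' (mem_closedBall_zero_iff.1 hx), fun x hx ↦ ?_, fun x hx ↦ ?_, fun x ↦ ?_⟩,
    fun x hx ↦
      norm_radialProductReparam_sq_eventuallyEq hgs.continuous hβ hbd hφ0 hid hτm hστ hlev' hx,
    fun x hx ↦ radialProductReparam_eq_self hφ0 hid hx, fun t ht t' ht' ↦ ?_⟩
  · -- the open disc is mapped into the open ball: same radius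
    have h := norm_radialProductReparam_sq hφ0 hid hτm hστ hlev' hx.le
    have h1 : ‖g x‖ ^ 2 < 1 := (sq_lt_one_iff₀ (norm_nonneg _)).2 (hgint x hx)
    exact (sq_lt_one_iff₀ (norm_nonneg _)).1 (by rw [h]; exact h1)
  · -- neatness: same radius function near the boundary circle
    have hev :=
      norm_radialProductReparam_sq_eventuallyEq hgs.continuous hβ hbd hφ0 hid hτm hστ hlev' hx.le
    rw [hev.fderiv_eq]
    exact hgneat x hx
  · -- boundary values
    have hx1 : ‖(x : EuclideanSpace ℝ (Fin 2))‖ = 1 := by simp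
    have h1 : ‖g x‖ ^ 2 ∉ Ioo α β := fun h ↦ by
      rw [hbd x hx1, one_pow] at h
      linarith [h.2]
    rw [radialProductReparam_eq_self hφ0 hid h1]
    exact hgK x
  · -- radial product structure on `[a, b]`
    have hta : t ∈ Icc α β := ⟨hαa.le.trans ht.1, ht.2.trans hbβ.le⟩
    have hta' : t' ∈ Icc α β := ⟨hαa.le.trans ht'.1, ht'.2.trans hbβ.le⟩
    have ht0 : 0 < t := hα.trans_le hta.1
    have ht0' : 0 < t' := hα.trans_le hta'.1
    rw [level_radialProductReparam hφ0 hφinv hid hτm hστ hlev' hta,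
      level_radialProductReparam hφ0 hφinv hid hτm hστ hlev' hta', hτa t ht, hτa t' ht', smul_smul]
    congr 1
    rw [hσeq t ht0, hσeq t' ht0', hτa t ht, hτa t' ht', ← Real.sqrt_mul (div_pos ht0' ht0).le]
    congr 1
    field_simp

/-! ### Iteration over disjoint product intervals -/

/-- **Straightening finitely many disjoint product intervals.** Given `δ > 0`, a slice disc `g`
of `K` and a list of pairs `(c, c')` with `0 ≤ c`, `c' ≤ 1`, `c + 2δ ≤ c'`, no critical point of
`ρ_g` on `ρ_g⁻¹[c + δ/2, c' - δ/2] ∩ 𝔻²`, and pairwise disjoint open intervals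
`(c + δ/2, c' - δ/2)`, there is a slice disc `g'` of `K` with the same radius function near `𝔻²`,
equal to `g` where `ρ_g` is in none of these intervals, and with radially constant level links
on each core `[c + δ, c' - δ]` (induction on the list with
`exists_isSliceDisc_radialProduct_step`; earlier product structures persist because later steps
do not move the levels in earlier cores). [cite: MilnorMorseTheory1963, §3 Thm. 3.1] -/
theorem Knot.IsSliceDisc.exists_isSliceDisc_radialProduct_list {K : Knot} {δ : ℝ} (hδ : 0 < δ)
    (L : List (ℝ × ℝ)) :
    ∀ {g : EuclideanSpace ℝ (Fin 2) → EuclideanSpace ℝ (Fin 4)}, K.IsSliceDisc g →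
      (∀ q ∈ L, 0 ≤ q.1 ∧ q.2 ≤ 1 ∧ q.1 + 2 * δ ≤ q.2 ∧
        ∀ x : EuclideanSpace ℝ (Fin 2), ‖x‖ ≤ 1 → ‖g x‖ ^ 2 ∈ Icc (q.1 + δ / 2) (q.2 - δ / 2) →
          fderiv ℝ (fun y ↦ ‖g y‖ ^ 2) x ≠ 0) →
      L.Pairwise (fun q q' ↦ Disjoint (Ioo (q.1 + δ / 2) (q.2 - δ / 2))
        (Ioo (q'.1 + δ / 2) (q'.2 - δ / 2))) →
      ∃ g' : EuclideanSpace ℝ (Fin 2) → EuclideanSpace ℝ (Fin 4), K.IsSliceDisc g' ∧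
        (∀ x : EuclideanSpace ℝ (Fin 2), ‖x‖ ≤ 1 →
          (fun y ↦ ‖g' y‖ ^ 2) =ᶠ[𝓝 x] fun y ↦ ‖g y‖ ^ 2) ∧
        (∀ x : EuclideanSpace ℝ (Fin 2), ‖x‖ ≤ 1 →
          (∀ q ∈ L, ‖g x‖ ^ 2 ∉ Ioo (q.1 + δ / 2) (q.2 - δ / 2)) → g' x = g x) ∧
        ∀ q ∈ L, ∀ t t' : ℝ, q.1 + δ ≤ t → t ≤ t' → t' ≤ q.2 - δ →
          {p | ∃ x, ‖x‖ ≤ 1 ∧ g' x = p ∧ ‖g' x‖ ^ 2 = t'} =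
            Real.sqrt (t' / t) • {p | ∃ x, ‖x‖ ≤ 1 ∧ g' x = p ∧ ‖g' x‖ ^ 2 = t} := by
  induction L with
  | nil =>
    intro g hg _ _
    exact ⟨g, hg, fun x _ ↦ EventuallyEq.rfl, fun x _ _ ↦ rfl, fun q hq ↦ by simp at hq⟩
  | cons q L ih =>
    intro g hg hL hP
    rw [List.pairwise_cons] at hP
    obtain ⟨g₁, hg₁, hρ₁, heq₁, hprod₁⟩ :=
      ih hg (fun q' hq' ↦ hL q' (List.mem_cons_of_mem _ hq')) hP.2
    obtain ⟨hq0, hq1, hqδ, hreg⟩ := hL q List.mem_cons_self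
    have hreg₁ : ∀ x : EuclideanSpace ℝ (Fin 2), ‖x‖ ≤ 1 →
        ‖g₁ x‖ ^ 2 ∈ Icc (q.1 + δ / 2) (q.2 - δ / 2) → fderiv ℝ (fun y ↦ ‖g₁ y‖ ^ 2) x ≠ 0 := by
      intro x hx hmem
      rw [(hρ₁ x hx).fderiv_eq]
      have e : ‖g₁ x‖ ^ 2 = ‖g x‖ ^ 2 := (hρ₁ x hx).self_of_nhds
      rw [e] at hmem
      exact hreg x hx hmem
    obtain ⟨g₂, hg₂, hρ₂, heq₂, hprod₂⟩ := hg₁.exists_isSliceDisc_radialProduct_step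
      (α := q.1 + δ / 2) (a := q.1 + δ) (b := q.2 - δ) (β := q.2 - δ / 2)
      (by linarith) (by linarith) (by linarith) (by linarith) (by linarith) hreg₁
    refine ⟨g₂, hg₂, fun x hx ↦ (hρ₂ x hx).trans (hρ₁ x hx), fun x hx hq ↦ ?_, ?_⟩
    · have h1 : ‖g₁ x‖ ^ 2 ∉ Ioo (q.1 + δ / 2) (q.2 - δ / 2) := by
        have e : ‖g₁ x‖ ^ 2 = ‖g x‖ ^ 2 := (hρ₁ x hx).self_of_nhds
        rw [e]
        exact hq q List.mem_cons_self
      rw [heq₂ x h1, heq₁ x hx (fun q' hq' ↦ hq q' (List.mem_cons_of_mem _ hq'))]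
    · intro q' hq' t t' h1t htt' ht'
      rcases List.mem_cons.1 hq' with rfl | hq'
      · exact hprod₂ t ⟨h1t, by linarith⟩ t' ⟨by linarith, ht'⟩
      · have hdisj := hP.1 q' hq'
        have hlevel : ∀ u : ℝ, q'.1 + δ ≤ u → u ≤ q'.2 - δ →
            {p | ∃ x, ‖x‖ ≤ 1 ∧ g₂ x = p ∧ ‖g₂ x‖ ^ 2 = u} =
              {p | ∃ x, ‖x‖ ≤ 1 ∧ g₁ x = p ∧ ‖g₁ x‖ ^ 2 = u} := by
          intro u hu1 hu2
          have hu : u ∉ Ioo (q.1 + δ / 2) (q.2 - δ / 2) := fun h ↦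
            Set.disjoint_left.1 hdisj h ⟨by linarith, by linarith⟩
          have key : ∀ x : EuclideanSpace ℝ (Fin 2), ‖x‖ ≤ 1 → ‖g₁ x‖ ^ 2 = u → g₂ x = g₁ x :=
            fun x hx hxu ↦ heq₂ x (by rw [hxu]; exact hu)
          ext p
          constructor
          · rintro ⟨x, hx, rfl, hxu⟩
            have e : ‖g₂ x‖ ^ 2 = ‖g₁ x‖ ^ 2 := (hρ₂ x hx).self_of_nhds
            rw [e] at hxu
            exact ⟨x, hx, (key x hx hxu).symm, hxu⟩
          · rintro ⟨x, hx, rfl, hxu⟩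
            refine ⟨x, hx, key x hx hxu, ?_⟩
            have e : ‖g₂ x‖ ^ 2 = ‖g₁ x‖ ^ 2 := (hρ₂ x hx).self_of_nhds
            rw [e]
            exact hxu
        rw [hlevel t' (by linarith) ht', hlevel t h1t (by linarith)]
        exact hprod₁ q' hq' t t' h1t htt' ht'

/-! ### The theorem -/

/-- **Slice discs with Morse radius function and radial product structure off the critical
windows.** For every smooth slice disc `f` of a knot `K` there is a finite set `S` of levels
(the critical values of the Morse radius function of the slice disc of
`exists_isSliceDisc_radialMorse`, all in `[0, 1)`) such that for every `δ > 0` there is a slice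
disc `g` of the **same** knot `K` with: `ρ_g = ‖g‖²` Morse on the open disc; `S` is exactly the
set of critical values of `ρ_g` on the open disc; and for `0 < t ≤ t' ≤ 1 - δ` such that
`[t, t']` avoids all the windows `(c - δ, c + δ)`, `c ∈ S`, the level links over the closed disc
satisfy `{g x | ‖x‖ ≤ 1, ‖g x‖² = t'} = √(t'/t) • {g x | ‖x‖ ≤ 1, ‖g x‖² = t}` — an exact
radial product structure between the critical levels, as in Milnor, *Morse theory* (1963),
Thm. 3.1 / *h-cobordism* (1965), Thm. 3.4, realised inside `B⁴` by the flow of `∇ρ/dρ(∇ρ)`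
on the disc and radial rescaling (`exists_isSliceDisc_radialProduct_step`, applied to the
consecutive pairs of `S ∪ {1}`). [cite: MilnorMorseTheory1963, §3 Thm. 3.1] -/
theorem Knot.IsSliceDisc.exists_isSliceDisc_radialProduct {K : Knot}
    {f : EuclideanSpace ℝ (Fin 2) → EuclideanSpace ℝ (Fin 4)} (hf : K.IsSliceDisc f) :
    ∃ S : Finset ℝ, ∀ δ : ℝ, 0 < δ →
      ∃ g : EuclideanSpace ℝ (Fin 2) → EuclideanSpace ℝ (Fin 4), K.IsSliceDisc g ∧
        (∀ x : EuclideanSpace ℝ (Fin 2), ‖x‖ < 1 → fderiv ℝ (fun y ↦ ‖g y‖ ^ 2) x = 0 →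
          ∀ v : EuclideanSpace ℝ (Fin 2), v ≠ 0 →
            ∃ w : EuclideanSpace ℝ (Fin 2), iteratedFDeriv ℝ 2 (fun y ↦ ‖g y‖ ^ 2) x ![v, w] ≠ 0) ∧
        (∀ c : ℝ, c ∈ S ↔ ∃ x : EuclideanSpace ℝ (Fin 2), ‖x‖ < 1 ∧
          fderiv ℝ (fun y ↦ ‖g y‖ ^ 2) x = 0 ∧ ‖g x‖ ^ 2 = c) ∧
        ∀ t t' : ℝ, 0 < t → t ≤ t' → t' ≤ 1 - δ → (∀ c ∈ S, t' ≤ c - δ ∨ c + δ ≤ t) →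
          {p | ∃ x, ‖x‖ ≤ 1 ∧ g x = p ∧ ‖g x‖ ^ 2 = t'} =
            Real.sqrt (t' / t) • {p | ∃ x, ‖x‖ ≤ 1 ∧ g x = p ∧ ‖g x‖ ^ 2 = t} := by
  classical
  obtain ⟨g₀, hg₀, hM₀⟩ := hf.exists_isSliceDisc_radialMorse
  have hgs₀ : ContDiff ℝ ∞ g₀ := hg₀.1
  have hρs₀ : ContDiff ℝ ∞ fun y ↦ ‖g₀ y‖ ^ 2 := hgs₀.norm_sq ℝ
  have hint₀ : ∀ x : EuclideanSpace ℝ (Fin 2), ‖x‖ < 1 → ‖g₀ x‖ < 1 := hg₀.2.2.2.1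
  have hneat₀ : ∀ x : EuclideanSpace ℝ (Fin 2), ‖x‖ = 1 → 0 < fderiv ℝ (fun y ↦ ‖g₀ y‖ ^ 2) x x :=
    hg₀.2.2.2.2.1
  have hK₀ := hg₀.2.2.2.2.2
  have hbd₀ : ∀ x : EuclideanSpace ℝ (Fin 2), ‖x‖ = 1 → ‖g₀ x‖ = 1 := fun x hx ↦ by
    rw [show g₀ x = _ from hK₀ ⟨x, by rwa [mem_sphere_zero_iff_norm]⟩, norm_eq_of_mem_sphere]
  -- critical points of `ρ₀` in the closed disc are interior (neatness) and finite in number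
  have hcritint : ∀ x : EuclideanSpace ℝ (Fin 2), ‖x‖ ≤ 1 → fderiv ℝ (fun y ↦ ‖g₀ y‖ ^ 2) x = 0 →
      ‖x‖ < 1 := fun x hx hc ↦
    lt_of_le_of_ne hx fun h ↦ by
      have := hneat₀ x h
      rw [hc] at this
      simp at this
  have hfin : {x ∈ closedBall (0 : EuclideanSpace ℝ (Fin 2)) 1 |
      fderiv ℝ (fun y ↦ ‖g₀ y‖ ^ 2) x = 0}.Finite :=
    finite_setOf_fderiv_eq_zero_of_nondegenerate hρs₀ (isCompact_closedBall 0 1) fun x hx hc ↦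
      hM₀ x (hcritint x (mem_closedBall_zero_iff.1 hx) hc) hc
  set S : Finset ℝ := hfin.toFinset.image fun x ↦ ‖g₀ x‖ ^ 2 with hSdef
  have hS : ∀ c, c ∈ S ↔ ∃ x : EuclideanSpace ℝ (Fin 2), ‖x‖ ≤ 1 ∧
      fderiv ℝ (fun y ↦ ‖g₀ y‖ ^ 2) x = 0 ∧ ‖g₀ x‖ ^ 2 = c := fun c ↦ by
    simp only [hSdef, Finset.mem_image, Set.Finite.mem_toFinset, mem_setOf_eq,
      mem_closedBall_zero_iff]
    constructor
    · rintro ⟨x, ⟨hx, hc⟩, rfl⟩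
      exact ⟨x, hx, hc, rfl⟩
    · rintro ⟨x, hx, hc, rfl⟩
      exact ⟨x, ⟨hx, hc⟩, rfl⟩
  have hS01 : ∀ c ∈ S, 0 ≤ c ∧ c < 1 := fun c hc ↦ by
    obtain ⟨x, hx, hcrit, rfl⟩ := (hS c).1 hc
    exact ⟨sq_nonneg _, (sq_lt_one_iff₀ (norm_nonneg _)).2 (hint₀ x (hcritint x hx hcrit))⟩
  -- the minimum of `ρ₀` on the disc is a critical value
  obtain ⟨c₀, hc₀S, hc₀min⟩ :
      ∃ c₀ ∈ S, ∀ x : EuclideanSpace ℝ (Fin 2), ‖x‖ ≤ 1 → c₀ ≤ ‖g₀ x‖ ^ 2 := by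
    obtain ⟨x₀, hx₀, hmin⟩ := (isCompact_closedBall (0 : EuclideanSpace ℝ (Fin 2)) 1).exists_isMinOn
      ⟨0, by simp⟩ hρs₀.continuous.continuousOn
    rw [mem_closedBall_zero_iff] at hx₀
    have hx₀1 : ‖x₀‖ < 1 := by
      refine lt_of_le_of_ne hx₀ fun h ↦ ?_
      have h0 : ‖g₀ x₀‖ ^ 2 ≤ ‖g₀ 0‖ ^ 2 := hmin (by simp)
      have h1 : ‖g₀ 0‖ < 1 := hint₀ 0 (by simp)
      have h2 : ‖g₀ x₀‖ = 1 := hbd₀ x₀ h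
      rw [h2] at h0
      nlinarith [norm_nonneg (g₀ 0)]
    have hcrit : fderiv ℝ (fun y ↦ ‖g₀ y‖ ^ 2) x₀ = 0 := by
      apply IsLocalMin.fderiv_eq_zero
      exact hmin.isLocalMin (mem_of_superset (isOpen_ball.mem_nhds (mem_ball_zero_iff.2 hx₀1))
        ball_subset_closedBall)
    exact ⟨_, (hS _).2 ⟨x₀, hx₀, hcrit, rfl⟩, fun x hx ↦ hmin (mem_closedBall_zero_iff.2 hx)⟩
  refine ⟨S, fun δ hδ ↦ ?_⟩
  -- the consecutive pairs of `P = S ∪ {1}` at distance `≥ 2δ`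
  set P : Finset ℝ := insert 1 S with hPdef
  have hP01 : ∀ c ∈ P, 0 ≤ c ∧ c ≤ 1 := fun c hc ↦ by
    rcases Finset.mem_insert.1 hc with rfl | hc
    · exact ⟨zero_le_one, le_rfl⟩
    · exact ⟨(hS01 c hc).1, (hS01 c hc).2.le⟩
  set Q : Finset (ℝ × ℝ) :=
    (P ×ˢ P).filter fun q ↦ q.1 + 2 * δ ≤ q.2 ∧ ∀ e ∈ P, ¬ (q.1 < e ∧ e < q.2) with hQdef
  have hQ : ∀ q, q ∈ Q ↔ q.1 ∈ P ∧ q.2 ∈ P ∧ q.1 + 2 * δ ≤ q.2 ∧ ∀ e ∈ P, ¬ (q.1 < e ∧ e < q.2) :=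
    fun q ↦ by simp only [hQdef, Finset.mem_filter, Finset.mem_product, and_assoc]
  have hhyp : ∀ q ∈ Q.toList, 0 ≤ q.1 ∧ q.2 ≤ 1 ∧ q.1 + 2 * δ ≤ q.2 ∧
      ∀ x : EuclideanSpace ℝ (Fin 2), ‖x‖ ≤ 1 → ‖g₀ x‖ ^ 2 ∈ Icc (q.1 + δ / 2) (q.2 - δ / 2) →
        fderiv ℝ (fun y ↦ ‖g₀ y‖ ^ 2) x ≠ 0 := by
    intro q hq
    rw [Finset.mem_toList, hQ] at hq
    obtain ⟨hq1, hq2, hqδ, hcons⟩ := hq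
    refine ⟨(hP01 _ hq1).1, (hP01 _ hq2).2, hqδ, fun x hx hmem hcrit ↦ ?_⟩
    have hcS : ‖g₀ x‖ ^ 2 ∈ S := (hS _).2 ⟨x, hx, hcrit, rfl⟩
    exact hcons _ (Finset.mem_insert_of_mem hcS) ⟨by linarith [hmem.1], by linarith [hmem.2]⟩
  have hpair : Q.toList.Pairwise (fun q q' ↦ Disjoint (Ioo (q.1 + δ / 2) (q.2 - δ / 2))
      (Ioo (q'.1 + δ / 2) (q'.2 - δ / 2))) := by
    refine (Finset.nodup_toList Q).pairwise_of_forall_ne fun q hq q' hq' hne ↦ ?_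
    rw [Finset.mem_toList, hQ] at hq hq'
    obtain ⟨hq1, hq2, hqδ, hcons⟩ := hq
    obtain ⟨hq1', hq2', hqδ', hcons'⟩ := hq'
    have hsep : q.2 ≤ q'.1 ∨ q'.2 ≤ q.1 := by
      by_contra h
      rw [not_or, not_le, not_le] at h
      obtain ⟨h1, h2⟩ := h
      rcases lt_trichotomy q.1 q'.1 with h3 | h3 | h3
      · exact hcons q'.1 hq1' ⟨h3, h1⟩
      · rcases lt_trichotomy q.2 q'.2 with h4 | h4 | h4
        · exact hcons' q.2 hq2 ⟨by rw [← h3]; linarith, h4⟩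
        · exact hne (Prod.ext h3 h4)
        · exact hcons q'.2 hq2' ⟨by rw [h3]; linarith, h4⟩
      · exact hcons' q.1 hq1 ⟨h3, h2⟩
    rcases hsep with h | h
    · exact Set.disjoint_left.2 fun u hu hu' ↦ by linarith [hu.2, hu'.1]
    · exact Set.disjoint_left.2 fun u hu hu' ↦ by linarith [hu.1, hu'.2]
  obtain ⟨g, hg, hρ, -, hprod⟩ :=
    Knot.IsSliceDisc.exists_isSliceDisc_radialProduct_list hδ Q.toList hg₀ hhyp hpair
  refine ⟨g, hg, ?_, ?_, ?_⟩
  · -- Morse: same radius function near every point of the disc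
    intro x hx hcrit v hv
    have he := hρ x hx.le
    rw [he.fderiv_eq] at hcrit
    obtain ⟨w, hw⟩ := hM₀ x hx hcrit v hv
    exact ⟨w, by rw [(he.iteratedFDeriv ℝ 2).self_of_nhds]; exact hw⟩
  · -- `S` is the set of critical values of `ρ_g` on the open disc
    intro c
    rw [hS]
    constructor
    · rintro ⟨x, hx, hc, rfl⟩
      exact ⟨x, hcritint x hx hc, by rw [(hρ x hx).fderiv_eq]; exact hc, (hρ x hx).self_of_nhds⟩
    · rintro ⟨x, hx, hc, rfl⟩
      exact ⟨x, hx.le, by rw [← (hρ x hx.le).fderiv_eq]; exact hc, ((hρ x hx.le).self_of_nhds).symm⟩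
  · -- the radial product structure off the windows
    intro t t' ht0 htt' ht'1 hwin
    by_cases hA : ∃ c ∈ P, c + δ ≤ t
    · set A : Finset ℝ := P.filter fun c ↦ c + δ ≤ t with hAdef
      have hAne : A.Nonempty := by
        obtain ⟨c, hc, h⟩ := hA
        exact ⟨c, Finset.mem_filter.2 ⟨hc, h⟩⟩
      set c : ℝ := A.max' hAne with hcdef
      have hcA : c ∈ A := A.max'_mem hAne
      obtain ⟨hcP, hct⟩ := Finset.mem_filter.1 hcA
      have hc1 : c < 1 := by linarith
      set B : Finset ℝ := P.filter fun e ↦ c < e with hBdef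
      have hBne : B.Nonempty := ⟨1, Finset.mem_filter.2 ⟨Finset.mem_insert_self _ _, hc1⟩⟩
      set c' : ℝ := B.min' hBne with hc'def
      have hc'B : c' ∈ B := B.min'_mem hBne
      obtain ⟨hc'P, hcc'⟩ := Finset.mem_filter.1 hc'B
      have ht'c' : t' ≤ c' - δ := by
        rcases Finset.mem_insert.1 hc'P with h | h
        · rw [h]; exact ht'1
        · rcases hwin c' h with h' | h'
          · exact h'
          · exfalso
            have h'' : c' ≤ c := A.le_max' c' (Finset.mem_filter.2 ⟨hc'P, h'⟩)
            linarith
      have hqQ : (c, c') ∈ Q := by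
        rw [hQ]
        refine ⟨hcP, hc'P, by linarith, fun e he h12 ↦ ?_⟩
        have h'' : c' ≤ e := B.min'_le e (Finset.mem_filter.2 ⟨he, h12.1⟩)
        linarith [h12.2]
      exact hprod (c, c') (Finset.mem_toList.2 hqQ) t t' hct htt' ht'c'
    · -- `t' < c₀ = min ρ`: both levels are empty
      have h1 : t < c₀ + δ := by
        by_contra h
        exact hA ⟨c₀, Finset.mem_insert_of_mem hc₀S, not_lt.1 h⟩
      have h2 : t' ≤ c₀ - δ := by
        rcases hwin c₀ hc₀S with h | h
        · exact h
        · linarith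
      have hempty : ∀ u : ℝ, u < c₀ →
          {p | ∃ x : EuclideanSpace ℝ (Fin 2), ‖x‖ ≤ 1 ∧ g x = p ∧ ‖g x‖ ^ 2 = u} = ∅ := by
        intro u hu
        rw [Set.eq_empty_iff_forall_notMem]
        rintro p ⟨x, hx, -, hxu⟩
        have e : ‖g x‖ ^ 2 = ‖g₀ x‖ ^ 2 := (hρ x hx).self_of_nhds
        rw [e] at hxu
        have := hc₀min x hx
        linarith
      rw [hempty t' (by linarith), hempty t (by linarith), smul_set_empty]

end Literature.Topology.FourManifolds
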